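import Summits.QuantumFields.YangMills.Theorems.LuscherReductionTwistedTraceScalingShellAssembly
import Summits.QuantumFields.YangMills.Theorems.LuscherReductionTwistedTraceScalingRecordSmallProfile
import Summits.QuantumFields.YangMills.Theorems.LuscherReductionTwistedTraceScalingRecordBricks
import Summits.QuantumFields.YangMills.Theorems.LuscherReductionTwistedTraceScalingBOAssembly
import Summits.QuantumFields.YangMills.Theorems.LuscherReductionTwistedTraceScalingValleySkeleton
import Summits.QuantumFields.YangMills.Theorems.LuscherReductionTwistedTraceScalingBTRatesAtoms
import HarnessLib

/-!
# ★★★ THE INNERMOST THIN C4-SHELL IS A THEOREM: `InnerShellGainSmallAt L (β^{−a}) (β^{−b}) (β^{−q})` for `1/6 < b < 1/5`, `0 < a < 1/5` — from the LANDED bricks of the C4-CORE record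
# (lane A of S-BASE, crux `TwistedTraceScaling` stmt-QuantumFields-20203, line «twolattice», stub `stub_fixedLatticeTraceLaw`; lead g23; card `pub/ym-fleet/ym-luscher-20007-p1/Lines-shell-gain.md` §4)

The sup-version BO assembly (✓`…ShellAssembly`: `ShellBricks → ShellGainOneOrbitAt`) instantiated at the tube of the C4-CORE record at exponent `b ∈ (1/6, 1/5)` (✓`boBricks_record` ∘
✓`recordAnalyticInput_r`: (B-T)_b, (B-ST)_b, (B-OD)_b, (B-N), supports — ALL in the tree):
* §1 ★ `floor_of_boBricks (K : BOBricks L χ δ) : ∀ᶠ β, e^{−λ_b(L³β)}·(K.σ β·μ₀(L³β)) ≤ λ₀(β,L)` — the FLOOR conjunct of ✓`softTubeBOPackageOn_of_bricks`, extracted with the brick list's own `σ`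
  (localized one-site near-maximiser ✓`exists_localized_near_top`, kernel brick, ✓`floor_clause_of_bricks`, eight copies);
* §2 `shellBricks_of_boBricks` — a `BOBricks L χ (β^{−b})` with admissibility, a profile supported in `{‖x‖ ≤ r β}`, `16|E|·r β ≤ β^{−a}` and `24|E|·β^{−c} ≤ β^{−a}` eventually, `a, c > 0`,
  `c < 1/5`, is a `ShellBricks L χ (β^{−a}) (β^{−b})` with one-site radius `t = β^{−c}` (inner shadow by ✓`orbitDist_orthoTube_le`; domination: the record's rates are `o(λ_b)` and
  `80(|A|+7+2/θ₀)·λ_b ≤ β^{−3c/2} = t√t` by ✓`powScale_dominates_bareLambda`, `3c/2 < 1/3`);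
* §3 ★★★ `innerShellGainSmallAt_record (hL2 : 2 ≤ L) (hb6 : 1/6 < b) (hb5 : b < 1/5) (ha0 : 0 < a) (ha5 : a < 1/5) (q) :
  InnerShellGainSmallAt L (powScale a) (powScale b) (powScale q)` — **the first SHELL-GAIN THEOREM**: every physical `φ` supported in
  `{∃ z, orbitDist(τ_z U) < β^{−b}} ∩ {∀ z, β^{−a}/2 < orbitDist(τ_z U)} ∩ {S < 2β^{−q}}` has `⟨φ,K_βφ⟩ ≤ e^{−A·λ_b(L³β)}·λ₀·‖φ‖²` for every `A`, eventually in `β`.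
WHAT IT IS NOT: the chain to COARSE-UPPER(L) needs thin shells with OUTER exponent `b ≤ 1/6` (down to `1/40`), whose (B-ST)_b/(B-OD)_b are OPEN (card §4); this instance covers only outer
exponents `b ∈ (1/6, 1/5)`.
HONEST FRAMING: fixed-lattice semiclassics (a sup bound on an annulus near the trivial orbit, fixed `L ≥ 2`, eventually in `β`) for a stub of a child of the CONDITIONAL reduction route
R2b1; C4-SHELL (as needed by the chain), COARSE-UPPER/LOWER/TAIL, the stubs and the crux stay OPEN; not infinite volume, not a mass gap, not Clay.  One `def` (a structure instance), no `sorry`.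
-/

set_option autoImplicit false

noncomputable section

open MeasureTheory Filter Topology Real
open scoped BigOperators
open Literature.MathematicalPhysics.QuantumFieldTheory
open Literature.MathematicalPhysics.QuantumLattice

namespace Summit.QuantumFields.YangMills.Theorems.FemtoTransferGap.TwoLattice.ConstTube

open Summit.QuantumFields.YangMills.Theorems.FemtoTransferGap
open Summit.QuantumFields.YangMills.Theorems.FemtoTransferGap.TwoLattice.Avg
open Summit.QuantumFields.YangMills.Theorems.FemtoTransferGap.TwoLattice.Stiff (LinkSpace)

variable {L : ℕ} [NeZero L]

/-! ## §1 The FLOOR of a brick list, with its own `σ` -/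

set_option maxHeartbeats 400000 in
/-- ★ **FLOOR in `σμ₀`-currency from a brick list**: `∀ᶠ β, e^{−λ_b(L³β)}·(K.σ β·μ₀(L³β)) ≤ λ₀(β, L)` — the floor conjunct of ✓`softTubeBOPackageOn_of_bricks` (at `ε = 1`), kept with
the brick list's `σ`. [cite: Luscher1983, §3] [cite: SjostrandZworski2007, §2] -/
theorem floor_of_boBricks {χ : ℝ → GaugeConfig 3 L SU2 → ℝ} {δ : ℝ → ℝ} (K : BOBricks L χ δ) :
    ∀ᶠ β : ℝ in atTop, Real.exp (-(bareLambda ((L : ℝ) ^ 3 * β))) * (K.σ β * levelValue su2Rep 1 ((L : ℝ) ^ 3 * β) 0) ≤ levelValue su2Rep L β 0 := by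
  have hL1 : (1 : ℝ) ≤ (L : ℝ) ^ 3 := one_le_pow₀ (by exact_mod_cast NeZero.one_le)
  obtain ⟨βNT, hNT⟩ := exists_localized_near_top (1 / 16) (by norm_num)
  obtain ⟨βc, hcross⟩ := crossBound_eventually_small (L := L) (m := K.m) K.hm0 (ε := 1 / 16) (by norm_num)
  filter_upwards [Filter.eventually_ge_atTop (max (max 2 βNT) βc), K.hκ_small (1 / 48) (by norm_num), K.hcore, K.hbo, K.hδ₂, K.hN, K.hT]
    with β hβ hκs hcore hbo hδ₂ hN hT
  have hβ2 : 2 ≤ β := ((le_max_left _ _).trans (le_max_left _ _)).trans hβ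
  have hβ1 : 1 ≤ β := by linarith only [hβ2]
  have hβ0 : 0 < β := by linarith only [hβ1]
  have hβNT : βNT ≤ β := ((le_max_right _ _).trans (le_max_left _ _)).trans hβ
  have hβc : βc ≤ β := (le_max_right _ _).trans hβ
  set B : ℝ := (L : ℝ) ^ 3 * β with hBdef
  have hBβ : β ≤ B := by rw [hBdef]; nlinarith only [hL1, hβ0]
  have hB0 : 0 < B := lt_of_lt_of_le hβ0 hBβ
  set lam : ℝ := bareLambda B with hlamdef
  have hlam0 : 0 < lam := bareLambda_pos' hB0
  have hlam1 : lam ≤ 1 := bareLambda_cube_le (L := L) one_pos (by norm_num; linarith only [hβ2])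
  have hμ0 : 0 < levelValue su2Rep 1 B 0 := levelValue_su2Rep_pos (L := 1) hB0 0
  have hκ0 := K.hκ β
  have hκy : K.κ β ≤ lam / 48 := by linarith only [hκs]
  have hκ1' : K.κ β ≤ 1 := by linarith only [hκy, hlam1]
  obtain ⟨Cw, hCw⟩ := K.hwb β
  obtain ⟨hc0, hcχ⟩ := K.hc β
  -- the localized near-maximiser and the kernel brick from below
  obtain ⟨φ₀, hφm, ⟨C₀, hC₀⟩, hφg, hφsupp, hφpos, hφtop⟩ := hNT B (hβNT.trans hBβ)
  have hφs : ∀ u, φ₀ u ≠ 0 → u ∈ K.𝒰 β := fun u hu => hcore u (hφsupp u hu)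
  have hTφ := hT φ₀ hφm ⟨C₀, hC₀⟩ hφg hφs
  have hTlow : K.σ β * K.γ β * (1 - K.κ β) * qform su2Rep B φ₀ φ₀ - K.κ β * K.σ β * K.γ β * levelValue su2Rep 1 B 0 * l2 φ₀ φ₀ ≤ tubeForm β (boFun L φ₀ (K.Ω β)) := by
    have := (abs_le.mp hTφ).1; linarith only [this]
  have hcB : 28 * crossBound L β K.m ≤ 1 / 16 * lam * levelValue su2Rep L β 0 :=
    (hcross β hβc).trans (mul_le_mul_of_nonneg_left (levelValue_zero_ge_uniform hβ1) (by positivity))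
  have harith : Real.exp (-(1 / 4 * lam)) * ((1 + 1 / 16 * lam / 4) * (1 + K.κ β)) ≤ (1 - K.κ β) * Real.exp (-(1 / 16 * lam)) - K.κ β := by
    have h := arith_floor hlam0.le hlam1 hκ0 hκy
    have e1 : lam / 4 = 1 / 4 * lam := by ring
    have e2 : lam / 64 = 1 / 16 * lam / 4 := by ring
    have e3 : lam / 16 = 1 / 16 * lam := by ring
    rw [e1, e2, e3] at h; exact h
  have hfl := floor_clause_of_bricks hβ0.le (K.hχm β) (K.hχ1 β) (K.hχ0 β) hc0 hcχ (K.hwm β) hCw (K.hΩm β) (K.hΩ1 β) K.hm hδ₂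
    (fun φ U hφ hU => hbo φ U hφ hU) (K.hσ β).le (K.hγ β) hκ0 hκ1' hN hφm hC₀ hφs hφpos hφtop hTlow hcB (by positivity) hμ0.le harith
  refine le_trans (mul_le_mul_of_nonneg_right (Real.exp_le_exp.mpr ?_) (mul_nonneg (K.hσ β).le hμ0.le)) hfl
  linarith only [hlam0]

/-! ## §2 A brick list at the outer radius is a shell brick list -/

/-- **Shell brick list from a BO brick list at the outer radius `β^{−b}`** with: admissibility, a profile supported in `{‖x‖ ≤ r β}` with `16|E|·r β ≤ β^{−a}` eventually, and a one-site radius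
`t = β^{−c}` with `24|E|·β^{−c} ≤ β^{−a}` eventually, `0 < c < 1/5`, `c < 2/9`. [cite: Luscher1983, §3] -/
def shellBricks_of_boBricks {χ : ℝ → GaugeConfig 3 L SU2 → ℝ} {a b c : ℝ} (K : BOBricks L χ (powScale b)) (hadm : SoftTubeAdmissible L (powScale b) χ)
    {r : ℝ → ℝ} (hΩr : ∀ β (x : LinkSpace L), K.Ω β x ≠ 0 → ‖x‖ ≤ r β) (hr2 : ∀ᶠ β in atTop, r β ≤ 1 / 2)
    (hra : ∀ᶠ β in atTop, 16 * (Fintype.card (Edge 3 L) : ℝ) * r β ≤ powScale a β)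
    (hc0 : 0 < c) (hc5 : c < 1 / 5) (hca : ∀ᶠ β in atTop, 24 * (Fintype.card (Edge 3 L) : ℝ) * powScale c β ≤ powScale a β) :
    ShellBricks L χ (powScale a) (powScale b) where
  Ω := K.Ω
  𝒰 := K.𝒰
  σ := K.σ
  γ := K.γ
  κ := K.κ
  b := K.b
  t := powScale c
  δ₁ := K.δ₁
  θ₀ := K.θ₀
  hadm := hadm
  hwm := K.hwm
  hwb := K.hwb
  hw0 := K.hw0
  hwinv := K.hwinv
  hΩm := K.hΩm
  hΩ1 := K.hΩ1
  hΩinv := K.hΩinv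
  h𝒰m := K.h𝒰m
  h𝒰inv := K.h𝒰inv
  h𝒰δ₁ := K.h𝒰δ₁
  hδ₁ := K.hδ₁
  hshadow := K.hshadow
  hshadowIn := by
    filter_upwards [hr2, hra, hca] with β hr2 hra hca
    intro u v _ hΩ hdist
    by_contra hlt
    push Not at hlt
    have hE : (0 : ℝ) < Fintype.card (Edge 3 L) := by exact_mod_cast Fintype.card_pos
    have hve : ∀ e, ‖v e‖ ≤ r β := fun e => (norm_apply_le_norm_linkEmbed v e).trans (hΩr β _ hΩ)
    have h := orbitDist_orthoTube_le (L := L) hlt.le hr2 hve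
    -- `|E|(4r + 6t) ≤ β^{-a}/4 + β^{-a}/4`
    have h1 : (Fintype.card (Edge 3 L) : ℝ) * (4 * r β) ≤ powScale a β / 4 := by nlinarith only [hra, hE]
    have h2 : (Fintype.card (Edge 3 L) : ℝ) * (6 * powScale c β) ≤ powScale a β / 4 := by nlinarith only [hca, hE]
    have h3 : (Fintype.card (Edge 3 L) : ℝ) * (4 * r β + 6 * powScale c β) ≤ powScale a β / 2 := by nlinarith only [h1, h2]
    linarith only [h, h3, hdist]
  hbo := by filter_upwards [K.hbo] with β h φ U hφ hU; exact (h φ U hφ hU).1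
  ht := by
    have hL1 : (1 : ℝ) ≤ (L : ℝ) ^ 3 := one_le_pow₀ (by exact_mod_cast NeZero.one_le)
    obtain ⟨β₅, h₅⟩ := powScale_eventually_le hc0 (show (0 : ℝ) < 1 / 5000 by norm_num)
    filter_upwards [Filter.eventually_ge_atTop (max 1 β₅)] with β hβ
    have hβ1 : 1 ≤ β := (le_max_left _ _).trans hβ
    have hβ0 : 0 < β := by linarith only [hβ1]
    refine ⟨?_, h₅ β ((le_max_right _ _).trans hβ)⟩
    -- `(L³β)^{-1/5} ≤ β^{-1/5} = powScale (1/5) β ≤ powScale c β`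
    have h1 : ((L : ℝ) ^ 3 * β) ^ (-(1 / 5 : ℝ)) ≤ β ^ (-(1 / 5 : ℝ)) := by
      rw [Real.rpow_neg (by positivity), Real.rpow_neg hβ0.le]
      exact inv_anti₀ (Real.rpow_pos_of_pos hβ0 _) (Real.rpow_le_rpow hβ0.le (by nlinarith only [hL1, hβ0]) (by norm_num))
    rw [← powScale_eq hβ1] at h1
    exact h1.trans (powScale_le_powScale hc5.le β)
  hσ := K.hσ
  hγ := K.hγ
  hκ := K.hκ
  hb := K.hb
  hθ₀ := K.hθ₀
  hfloor := floor_of_boBricks K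
  hdom := by
    intro A
    obtain ⟨hθ0, hθ1⟩ := K.hθ₀
    have hc3 : 3 * c / 2 < 1 / 3 := by linarith only [hc5]
    obtain ⟨βg, hg⟩ := powScale_dominates_bareLambda (L := L) hc3 (80 * (|A| + 7 + 2 / K.θ₀))
    obtain ⟨βθ, hθ⟩ := powScale_dominates_bareLambda (L := L) (show (0 : ℝ) < 1 / 3 by norm_num) (2 * (|A| + 1) / K.θ₀)
    filter_upwards [Filter.eventually_ge_atTop (max (max 1 βg) βθ), K.hκ_small 1 one_pos, K.hb_small 1 one_pos] with β hβ hκs hbs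
    have hβ1 : 1 ≤ β := ((le_max_left _ _).trans (le_max_left _ _)).trans hβ
    have hβ0 : 0 < β := by linarith only [hβ1]
    have hL1 : (1 : ℝ) ≤ (L : ℝ) ^ 3 := one_le_pow₀ (by exact_mod_cast NeZero.one_le)
    have hB0 : 0 < (L : ℝ) ^ 3 * β := by nlinarith only [hL1, hβ0]
    have hlam0 : 0 < bareLambda ((L : ℝ) ^ 3 * β) := bareLambda_pos' hB0
    have hA : A * bareLambda ((L : ℝ) ^ 3 * β) ≤ |A| * bareLambda ((L : ℝ) ^ 3 * β) := mul_le_mul_of_nonneg_right (le_abs_self A) hlam0.le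
    -- `t√t = powScale (3c/2) β`
    have hsq : Real.sqrt (powScale c β) = powScale (c / 2) β := by
      unfold powScale
      rw [Real.sqrt_eq_rpow, ← Real.rpow_mul (by positivity)]
      ring_nf
    have htt : powScale c β * Real.sqrt (powScale c β) = powScale (3 * c / 2) β := by
      rw [hsq, powScale_mul_powScale]; ring_nf
    constructor
    · have h1 := hg β (((le_max_right _ _).trans (le_max_left _ _)).trans hβ)
      have h2 : 6 * K.κ β + 2 * K.b β ^ 2 / K.θ₀ ≤ (6 + 2 / K.θ₀) * bareLambda ((L : ℝ) ^ 3 * β) := by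
        have e : (6 + 2 / K.θ₀) * bareLambda ((L : ℝ) ^ 3 * β) = 6 * (1 * bareLambda ((L : ℝ) ^ 3 * β)) + 2 * (1 * bareLambda ((L : ℝ) ^ 3 * β)) / K.θ₀ := by ring
        rw [e]
        have h3 : 2 * K.b β ^ 2 / K.θ₀ ≤ 2 * (1 * bareLambda ((L : ℝ) ^ 3 * β)) / K.θ₀ := div_le_div_of_nonneg_right (by linarith only [hbs]) hθ0.le
        linarith only [hκs, h3]
      rw [htt]
      have h4 : (|A| + 7 + 2 / K.θ₀) * bareLambda ((L : ℝ) ^ 3 * β) ≤ powScale (3 * c / 2) β / 80 := by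
        have : 80 * (|A| + 7 + 2 / K.θ₀) * bareLambda ((L : ℝ) ^ 3 * β) ≤ powScale (3 * c / 2) β := h1
        linarith only [this]
      nlinarith only [hA, h2, h4, hlam0]
    · have h1 := hθ β ((le_max_right _ _).trans hβ)
      have hp1 : powScale 0 β ≤ 1 := powScale_le_one le_rfl β
      have h2 : 2 * (|A| + 1) / K.θ₀ * bareLambda ((L : ℝ) ^ 3 * β) ≤ 1 := h1.trans hp1
      have h3 : 2 * (|A| + 1) * bareLambda ((L : ℝ) ^ 3 * β) ≤ K.θ₀ := by
        have := mul_le_mul_of_nonneg_right h2 hθ0.le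
        rw [one_mul] at this
        have e : 2 * (|A| + 1) / K.θ₀ * bareLambda ((L : ℝ) ^ 3 * β) * K.θ₀ = 2 * (|A| + 1) * bareLambda ((L : ℝ) ^ 3 * β) := by field_simp
        linarith only [this, e]
      nlinarith only [hA, h3, hlam0, abs_nonneg A]
  hN := K.hN
  hT := K.hT
  hST := K.hST
  hOD := K.hOD

/-! ## §3 ★★★ The innermost thin shell is a theorem -/

set_option maxHeartbeats 800000 in
/-- ★★★ **THE INNERMOST THIN C4-SHELL GAIN** (`L ≥ 2`, `1/6 < b < 1/5`, `0 < a < 1/5`, any `q`): `InnerShellGainSmallAt L (powScale a) (powScale b) (powScale q)` — every physical `φ` supported in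
`{∃ z, orbitDist(τ_z U) < β^{−b}} ∩ {∀ z, β^{−a}/2 < orbitDist(τ_z U)} ∩ {S < 2β^{−q}}` has `⟨φ, K_β φ⟩ ≤ e^{−A·λ_b(L³β)}·λ₀(β,L)·‖φ‖²` for every `A`, eventually in `β`.  The C4-CORE record at
exponent `b` (✓`recordAnalyticInput_r`, ✓`boBricks_record`, ✓`fpWeight_core_constant`) is a shell brick list (§2) with `t = β^{−c}`, `c = (max a b + 1/5)/2`; then ✓`innerShellGainSmallAt_of_shellBricks`.
[cite: Luscher1983, §3] [cite: SimonB1983DiscreteSpectrum, §3] -/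
theorem innerShellGainSmallAt_record (hL2 : 2 ≤ L) {a b : ℝ} (hb6 : 1 / 6 < b) (hb5 : b < 1 / 5) (ha0 : 0 < a) (ha5 : a < 1 / 5) (q : ℝ) :
    InnerShellGainSmallAt L (powScale a) (powScale b) (powScale q) := by
  have hLz : Nonempty (NzSite L) := nonempty_nzSite_of_two_le hL2
  have hb0 : 0 < b := by linarith
  have hb4 : b < 1 / 4 := by linarith
  have hE : (0 : ℝ) < Fintype.card (Edge 3 L) := by exact_mod_cast Fintype.card_pos
  -- the record with its profile radius, and the FP-weight sandwich for the brick list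
  obtain ⟨M₀, hM₀, hrec⟩ := recordAnalyticInput_r (L := L) hLz hL2 hb6 hb4
  have hδ0 : ∀ β, 0 < 43 * powScale b β := fun β => mul_pos (by norm_num) (powScale_pos b β)
  have hδt : Tendsto (fun β => 43 * powScale b β) atTop (𝓝 0) := by
    have := (tendsto_powScale hb0).const_mul 43; simpa using this
  have hsd : ∀ᶠ β in atTop, 0 < powScale 1 β ∧ powScale 1 β ≤ (43 * powScale b β) ^ 3 := by
    filter_upwards [Filter.eventually_ge_atTop (1 : ℝ)] with β hβ
    refine ⟨powScale_pos 1 β, (powScale_one_le_cube (σ := b) (by linarith) hβ).trans ?_⟩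
    have hp := powScale_pos b β
    have h1 : powScale b β ≤ 43 * powScale b β := by nlinarith
    exact pow_le_pow_left₀ hp.le h1 3
  obtain ⟨M₁, hM₁, hPM⟩ := fpWeight_core_constant L hLz hδ0 hδt hsd
  set M : ℝ := max M₀ M₁
  have hM0M : M₀ ≤ M := le_max_left _ _
  have hM1M : M₁ ≤ M := le_max_right _ _
  have hM2 : 2 ≤ M := hM₀.trans hM0M
  have hM1 : 1 ≤ M := by linarith
  obtain ⟨A, hAr⟩ := hrec M hM0M
  obtain ⟨C, β₀, -, hP⟩ := hPM M hM1M
  set I : RecordBOInput L b 43 M := A.toRecordBOInput hb0 hb5 (by linarith)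
  -- NB: the brick list's `Ω` is `A.Ω` definitionally; we keep the record's radius for it.
  have hKΩ : ∀ β (x : LinkSpace L), (boBricks_record hb0 hM1 I (C := C) (β₀ := β₀) fun β hβ U hU => hP β hβ U hU).Ω β x ≠ 0 →
      ‖x‖ ≤ powScale (1 / 2) β * btLog β := fun β x hx => hAr β x hx
  -- admissibility of the record weight
  have hadm : SoftTubeAdmissible L (powScale b) (recordChi L b 43 M) :=
    softTubeAdmissible_mono (fun β => by have := powScale_pos b β; show powScale b β ≤ 43 * powScale b β; nlinarith)
      (softTubeAdmissible_recordWeightRho L hδ0 (fun β => by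
        have : 0 ≤ 43 * powScale b β := (hδ0 β).le
        show 2 * (43 * powScale b β) ≤ M * (43 * powScale b β); nlinarith))
  -- the one-site radius exponent
  set c : ℝ := (max a b + 1 / 5) / 2 with hcdef
  have hcmax : max a b < 1 / 5 := max_lt ha5 hb5
  have hc0 : 0 < c := by rw [hcdef]; have := le_max_left a b; linarith
  have hc5 : c < 1 / 5 := by rw [hcdef]; linarith
  have hca0 : 0 < c - a := by rw [hcdef]; have := le_max_left a b; linarith
  -- eventual comparisons of the radii
  have hr2 : ∀ᶠ β : ℝ in atTop, powScale (1 / 2) β * btLog β ≤ 1 / 2 :=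
    tendsto_rf.eventually (eventually_le_nhds (by norm_num))
  have hra : ∀ᶠ β : ℝ in atTop, 16 * (Fintype.card (Edge 3 L) : ℝ) * (powScale (1 / 2) β * btLog β) ≤ powScale a β := by
    have ht := tendsto_powScale_mul_btLog_pow (p := 1 / 2 - a) (by linarith) 1
    have hpos : (0 : ℝ) < 1 / (16 * Fintype.card (Edge 3 L)) := by positivity
    filter_upwards [ht.eventually (eventually_le_nhds hpos)] with β hβ
    rw [pow_one] at hβ
    have e : powScale (1 / 2) β = powScale a β * powScale (1 / 2 - a) β := by rw [powScale_mul_powScale]; ring_nf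
    rw [e]
    have hpa := powScale_pos a β
    have h1 : 16 * (Fintype.card (Edge 3 L) : ℝ) * (powScale (1 / 2 - a) β * btLog β) ≤ 1 := by
      have := mul_le_mul_of_nonneg_left hβ (show (0 : ℝ) ≤ 16 * Fintype.card (Edge 3 L) by positivity)
      have e2 : 16 * (Fintype.card (Edge 3 L) : ℝ) * (1 / (16 * Fintype.card (Edge 3 L))) = 1 := by field_simp
      linarith only [this, e2]
    nlinarith only [h1, hpa]
  have hca : ∀ᶠ β : ℝ in atTop, 24 * (Fintype.card (Edge 3 L) : ℝ) * powScale c β ≤ powScale a β := by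
    have ht := tendsto_powScale hca0
    have hpos : (0 : ℝ) < 1 / (24 * Fintype.card (Edge 3 L)) := by positivity
    filter_upwards [ht.eventually (eventually_le_nhds hpos)] with β hβ
    have e : powScale c β = powScale a β * powScale (c - a) β := by rw [powScale_mul_powScale]; ring_nf
    rw [e]
    have hpa := powScale_pos a β
    have h1 : 24 * (Fintype.card (Edge 3 L) : ℝ) * powScale (c - a) β ≤ 1 := by
      have := mul_le_mul_of_nonneg_left hβ (show (0 : ℝ) ≤ 24 * Fintype.card (Edge 3 L) by positivity)
      have e2 : 24 * (Fintype.card (Edge 3 L) : ℝ) * (1 / (24 * Fintype.card (Edge 3 L))) = 1 := by field_simp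
      linarith only [this, e2]
    nlinarith only [h1, hpa]
  have S : ShellBricks L (recordChi L b 43 M) (powScale a) (powScale b) :=
    shellBricks_of_boBricks (boBricks_record hb0 hM1 I (C := C) (β₀ := β₀) fun β hβ U hU => hP β hβ U hU) hadm hKΩ hr2 hra hc0 hc5 hca
  exact innerShellGainSmallAt_of_shellBricks hb0 S

end Summit.QuantumFields.YangMills.Theorems.FemtoTransferGap.TwoLattice.ConstTube

end
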